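import Literature.Geometry.Kaehler.ComplexTorusChainPeriods
import Literature.Geometry.Kaehler.AnalyticSetChain
import Literature.Geometry.Kaehler.AnalyticSetBiholomorph
import Literature.Geometry.GeometricMeasureTheory.DilationInvariance
import HarnessLib

/-!
# `Λ`-periodic analytic sets: the period functional of `A/Λ` does not depend on the fundamental domain

Layer `Literature/Geometry/Kaehler`; lane `lit-hodgefound`, Layer A4, row A4-18 (b) stage (ii)
(`run/shared/lean/pub/lit-hodgefound/SKELETON.md` §P Q58, node N3′ of
`lit-hodgefound-p07/Q58-STAGING.md`). A closed analytic subvariety `Z` of pure dimension `d` of the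
complex torus `X = E/Λ`, `Λ = Φ(ℤ^ι)`, is the same thing as a `Λ`-PERIODIC pure `d`-dimensional
analytic subset `A = π⁻¹(Z)` of `E` (Lange (2023), §1.1.4: objects on `X` are the `Λ`-periodic objects
on `V`; Griffiths–Harris, Ch. 2 §6), and its current of integration on the invariant forms of `X` is
the period functional `HolomorphicChain.torusPeriod Φ [A]` of the chain `[A] = HolomorphicChain.ofSet A`
(Chirka (1989), §14.1: `⟨[A], φ⟩ = ∫_{reg A} φ`) over a fundamental domain of `Λ`
(`ComplexTorusChainPeriods.lean`). This file proves that for such `A` the data of `[A]` relevant to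
the integral are `Λ`-periodic, so that the period functional is intrinsic:

* `HolomorphicChain.orientationFrame_const_add` — for ANY holomorphic chain whose carrier is invariant
  under a translation `x ↦ b + x`, the orientation frame is invariant too: the approximate tangent
  cone of `𝓗^{2p} ⌞ reg|T|` is translation-equivariant (Federer 3.2.16; tree
  `approxTangentCone_restrict_preimage_add_smul`) and `ξ_T` is read off it;
  `HolomorphicChain.IsLatticePeriodic.of_carrier_of_density` — hence `Λ`-periodicity of a chain
  (`ComplexTorusChainPeriods.lean`) only needs the carrier and the density;
* `HolomorphicChain.constPeriod_eq_of_periodic_carrier`, `torusPeriod_eq_constPeriod_of_periodic_carrier`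
  — INDEPENDENCE OF THE FUNDAMENTAL DOMAIN under the weaker hypotheses "carrier `Λ`-periodic, density
  `Λ`-periodic ON the carrier" (the integrand is modified off the carrier, a `𝓗^{2p} ⌞ reg|T|`-null set,
  to a `Λ`-invariant function; then Mathlib's `IsAddFundamentalDomain.setIntegral_eq`);
* `ComplexTorus.translateTop b` — the translation `x ↦ b + x` as a biholomorphic self-homeomorphism of
  the complex manifold `⊤ : Opens E`; `regularLocus_translateTop` — the regular locus of a
  translation-invariant subset is translation-invariant (regular points are invariant under
  biholomorphisms, tree `mem_regularLocus_of_preimage_homeomorph`, Chirka §2.3);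
* **`HolomorphicChain.carrier_ofSet_periodic`**, **`HolomorphicChain.isLatticePeriodic_ofSet`**'s
  substitute **`torusPeriod_ofSet_eq_constPeriod`** — for a `Λ`-periodic pure `p`-dimensional analytic
  `A ⊆ E`: `reg A` is `Λ`-periodic, the density of `[A]` is `1` on it, and therefore
  `torusPeriod Φ [A] = constPeriod [A] D` for EVERY admissible fundamental domain `D` of `Λ` (and every
  period box, `torusPeriod_ofSet_eq_constPeriod_periodBox`): the period functional `ω ↦ ∫_{A/Λ} ω` of the
  analytic cycle `A/Λ ⊂ X` on `H^{2p}(X, ℂ)` is well defined.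

Definitions with bodies (`translateTop`) and theorems; no named fact.

## References

* [Lange2023AbelianVarietiesComplex] H. Lange, *Abelian Varieties over the Complex Numbers*, Springer
  (2023), §1.1.1, §1.1.4.
* [Chirka1989] E. M. Chirka, *Complex Analytic Sets*, Kluwer (1989), §2.3 (regular points), §14.1.
* [Federer1969] H. Federer, *Geometric Measure Theory*, Springer (1969), 3.2.16.
* [VoisinHodgeI2002] C. Voisin, *Hodge Theory and Complex Algebraic Geometry I*, CUP (2002), §11.1.2.
-/

noncomputable section

open scoped Manifold ENNReal NNReal Pointwise ContDiff
open MeasureTheory TopologicalSpace Set Function Complex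
open Literature.Geometry.GeometricMeasureTheory

namespace Literature.Geometry.Kaehler

-- Nested operator-norm instances on `Covector V m` / `Multivector V m`, as in `Currents.lean`.
set_option maxSynthPendingDepth 2

universe u

/-! ### Translation-invariant carriers have translation-invariant orientation frames -/

namespace HolomorphicChain

section General

variable {V : Type u} [NormedAddCommGroup V] [InnerProductSpace ℂ V] [FiniteDimensional ℂ V]
  [MeasurableSpace V] [BorelSpace V] {Ω : Opens V} {p : ℕ}

/-- **The orientation frame of a chain with translation-invariant carrier is translation-invariant**:
if `b + reg|T| = reg|T|` then `ξ_T(b + x) = ξ_T(x)` — the approximate tangent cone of `𝓗^{2p} ⌞ reg|T|`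
at `b + x` is that at `x` (Federer 3.2.16, translation equivariance), and `ξ_T` is the complex
orientation frame of a unitary frame spanning it. [cite: Federer1969, 3.2.16] -/
theorem orientationFrame_const_add (T : HolomorphicChain 𝓘(ℂ, V) Ω p) {b : V}
    (hcar : (fun x ↦ b + x) ⁻¹' T.carrier = T.carrier) (x : V) :
    T.orientationFrame (b + x) = T.orientationFrame x := by
  letI : InnerProductSpace ℝ V := InnerProductSpace.complexToReal
  have hWm : MeasurableSet T.carrier := T.isRectifiableData.1
  have key : approxTangentCone (2 * p) ((μHE[2 * p] : Measure V).restrict T.carrier) (b + x) =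
      approxTangentCone (2 * p) ((μHE[2 * p] : Measure V).restrict T.carrier) x := by
    have h := approxTangentCone_restrict_preimage_add_smul (m := 2 * p) hWm b x one_pos
    simp only [one_smul] at h
    rw [hcar] at h
    exact h.symm
  unfold HolomorphicChain.orientationFrame
  rw [key]

end General

/-! ### Independence of the fundamental domain from periodicity of the carrier -/

section Periodic

variable {ι : Type*} {E : Type u} [NormedAddCommGroup E] [InnerProductSpace ℂ E]
  [FiniteDimensional ℂ E] [MeasurableSpace E] [BorelSpace E] (Φ : (ι → ℝ) ≃L[ℝ] E)
  {Ω : Opens E} {p : ℕ}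

/-- `Λ`-periodicity of a chain needs only the carrier and the density: the orientation frame follows
(`orientationFrame_const_add`). [cite: Lange2023AbelianVarietiesComplex, §1.1.4] -/
theorem IsLatticePeriodic.of_carrier_of_density {T : HolomorphicChain 𝓘(ℂ, E) Ω p}
    (hcar : ∀ (m : ι → ℤ) (x : E), ComplexTorus.latticeVec Φ m + x ∈ T.carrier ↔ x ∈ T.carrier)
    (hdens : ∀ (m : ι → ℤ) (x : E), T.density (ComplexTorus.latticeVec Φ m + x) = T.density x) :
    T.IsLatticePeriodic Φ :=
  ⟨hcar, hdens, fun m x ↦ T.orientationFrame_const_add (Set.ext fun y ↦ hcar m y) x⟩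

/-- A `G`-invariant measure restricted to a measurable `G`-invariant set is `G`-invariant. [folklore] -/
private theorem vaddInvariantMeasure_restrict' {G α : Type*} [AddGroup G] [AddAction G α]
    [MeasurableSpace α] [MeasurableConstVAdd G α] {μ : Measure α} [VAddInvariantMeasure G α μ]
    {s : Set α} (hs : MeasurableSet s) (hinv : ∀ g : G, (fun x ↦ g +ᵥ x) ⁻¹' s = s) :
    VAddInvariantMeasure G α (μ.restrict s) := by
  refine ⟨fun g t ht ↦ ?_⟩
  have hgt : MeasurableSet ((fun x ↦ g +ᵥ x) ⁻¹' t) := measurable_const_vadd g ht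
  rw [Measure.restrict_apply hgt, Measure.restrict_apply ht]
  conv_lhs => rw [← hinv g, ← preimage_inter]
  exact VAddInvariantMeasure.measure_preimage_vadd g (ht.inter hs)

variable [Fintype ι]

/-- **Independence of the fundamental domain, from periodicity of the carrier.** If the carrier of a
holomorphic `p`-chain `T` on `E` is `Λ`-periodic and its density is `Λ`-periodic ON the carrier, then
the periods on constant forms over any two admissible fundamental domains of `Λ` agree (the integrand
`θ_T ω(ξ_T)`, modified to `0` off the carrier — a `𝓗^{2p} ⌞ reg|T|`-null modification — is
`Λ`-invariant; Mathlib's `IsAddFundamentalDomain.setIntegral_eq`).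
[cite: Lange2023AbelianVarietiesComplex, §1.1.4] -/
theorem constPeriod_eq_of_periodic_carrier (T : HolomorphicChain 𝓘(ℂ, E) Ω p)
    (hcar : ∀ (m : ι → ℤ) (x : E), ComplexTorus.latticeVec Φ m + x ∈ T.carrier ↔ x ∈ T.carrier)
    (hdens : ∀ (m : ι → ℤ), ∀ x ∈ T.carrier, T.density (ComplexTorus.latticeVec Φ m + x) = T.density x)
    {D D' : Set E}
    (hD : IsAddFundamentalDomain (ComplexTorus.periodLattice Φ) D
      ((μHE[2 * p] : Measure E).restrict T.carrier))
    (hD' : IsAddFundamentalDomain (ComplexTorus.periodLattice Φ) D'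
      ((μHE[2 * p] : Measure E).restrict T.carrier))
    (hDi : IntegrableOn (fun x ↦ (T.density x : ℝ) • frameVector (T.orientationFrame x)) D
      ((μHE[2 * p] : Measure E).restrict T.carrier))
    (hD'i : IntegrableOn (fun x ↦ (T.density x : ℝ) • frameVector (T.orientationFrame x)) D'
      ((μHE[2 * p] : Measure E).restrict T.carrier)) :
    T.constPeriod D = T.constPeriod D' := by
  letI : InnerProductSpace ℝ E := InnerProductSpace.complexToReal
  have hWm : MeasurableSet T.carrier := T.isRectifiableData.1
  have hcar' : ∀ m : ι → ℤ, (fun x ↦ ComplexTorus.latticeVec Φ m + x) ⁻¹' T.carrier = T.carrier :=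
    fun m ↦ Set.ext fun y ↦ hcar m y
  have hinv : ∀ g : ComplexTorus.periodLattice Φ, (fun x ↦ g +ᵥ x) ⁻¹' T.carrier = T.carrier := by
    intro g
    obtain ⟨m, hm⟩ := (ComplexTorus.mem_periodLattice_iff Φ).1 g.2
    ext x
    rw [mem_preimage, ComplexTorus.periodLattice_vadd, ← hm]
    exact hcar m x
  haveI : VAddInvariantMeasure (ComplexTorus.periodLattice Φ) E
      ((μHE[2 * p] : Measure E).restrict T.carrier) := vaddInvariantMeasure_restrict' hWm hinv
  ext η
  rw [T.constPeriod_apply hDi, T.constPeriod_apply hD'i]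
  -- the integrand, modified to `0` off the carrier, is `Λ`-invariant
  have hfg : ∀ᵐ x ∂((μHE[2 * p] : Measure E).restrict T.carrier),
      ((T.density x : ℝ) : ℂ) * η (T.orientationFrame x) =
        T.carrier.indicator (fun y ↦ ((T.density y : ℝ) : ℂ) * η (T.orientationFrame y)) x := by
    filter_upwards [ae_restrict_mem hWm] with x hx
    simp only [indicator_of_mem hx]
  have hg : ∀ (γ : ComplexTorus.periodLattice Φ) (x : E),
      T.carrier.indicator (fun y ↦ ((T.density y : ℝ) : ℂ) * η (T.orientationFrame y)) (γ +ᵥ x) =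
        T.carrier.indicator (fun y ↦ ((T.density y : ℝ) : ℂ) * η (T.orientationFrame y)) x := by
    intro γ x
    obtain ⟨m, hm⟩ := (ComplexTorus.mem_periodLattice_iff Φ).1 γ.2
    rw [ComplexTorus.periodLattice_vadd, ← hm]
    by_cases hx : x ∈ T.carrier
    · simp only [indicator_of_mem hx, indicator_of_mem ((hcar m x).2 hx), hdens m x hx,
        T.orientationFrame_const_add (hcar' m)]
    · simp only [indicator_of_notMem hx, indicator_of_notMem (mt (hcar m x).1 hx)]
  rw [integral_congr_ae (ae_restrict_of_ae hfg), integral_congr_ae (ae_restrict_of_ae hfg)]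
  exact hD.setIntegral_eq hD' hg

/-- The period functional over the standard box equals that over any admissible fundamental domain,
for a chain on `E` with `Λ`-periodic carrier and density periodic on the carrier.
[cite: Lange2023AbelianVarietiesComplex, §1.1.4] -/
theorem torusPeriod_eq_constPeriod_of_periodic_carrier (T : HolomorphicChain 𝓘(ℂ, E) (⊤ : Opens E) p)
    (hcar : ∀ (m : ι → ℤ) (x : E), ComplexTorus.latticeVec Φ m + x ∈ T.carrier ↔ x ∈ T.carrier)
    (hdens : ∀ (m : ι → ℤ), ∀ x ∈ T.carrier, T.density (ComplexTorus.latticeVec Φ m + x) = T.density x)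
    {D : Set E}
    (hD : IsAddFundamentalDomain (ComplexTorus.periodLattice Φ) D
      ((μHE[2 * p] : Measure E).restrict T.carrier))
    (hDi : IntegrableOn (fun x ↦ (T.density x : ℝ) • frameVector (T.orientationFrame x)) D
      ((μHE[2 * p] : Measure E).restrict T.carrier)) :
    T.torusPeriod Φ = T.constPeriod D :=
  T.constPeriod_eq_of_periodic_carrier Φ hcar hdens (ComplexTorus.isAddFundamentalDomain_periodBox Φ 0 _)
    hD (T.integrableOn_density_smul_frameVector_periodBox Φ 0) hDi

end Periodic

end HolomorphicChain

/-! ### Translations as biholomorphisms of the manifold `⊤ : Opens E` -/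

namespace ComplexTorus

section Translate

variable {E : Type u} [NormedAddCommGroup E]

/-- The translation `x ↦ b + x` as a self-homeomorphism of (the manifold) `⊤ : Opens E`.
[cite: Lange2023AbelianVarietiesComplex, §1.1.4] -/
def translateTop (b : E) : (⊤ : Opens E) ≃ₜ (⊤ : Opens E) :=
  (Homeomorph.addLeft b).subtype fun _ ↦ ⟨fun _ ↦ trivial, fun _ ↦ trivial⟩

/-- `translateTop b x = b + x` in `E`. [cite: Lange2023AbelianVarietiesComplex, §1.1.4] -/
@[simp] theorem coe_translateTop (b : E) (x : (⊤ : Opens E)) :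
    ((translateTop b x : (⊤ : Opens E)) : E) = b + x := rfl

/-- The inverse translation is the translation by `-b`. [cite: Lange2023AbelianVarietiesComplex, §1.1.4] -/
@[simp] theorem coe_translateTop_symm (b : E) (x : (⊤ : Opens E)) :
    (((translateTop b).symm x : (⊤ : Opens E)) : E) = -b + x := rfl

variable [NormedSpace ℂ E]

/-- Translations are holomorphic self-maps of the manifold `⊤ : Opens E`. [cite: Lange2023AbelianVarietiesComplex, §1.1.4] -/
theorem contMDiff_translateTop (b : E) : ContMDiff 𝓘(ℂ, E) 𝓘(ℂ, E) ∞ (translateTop b) := by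
  rw [← ContMDiff.subtypeVal_comp_iff]
  have h : (Subtype.val ∘ translateTop b : (⊤ : Opens E) → E) = (fun y : E ↦ b + y) ∘ Subtype.val := by
    funext x; rfl
  rw [h]
  exact (contDiff_const.add contDiff_id).contMDiff.comp contMDiff_subtype_val

/-- Translations are `MDifferentiable`. [cite: Lange2023AbelianVarietiesComplex, §1.1.4] -/
theorem mdifferentiable_translateTop (b : E) : MDifferentiable 𝓘(ℂ, E) 𝓘(ℂ, E) (translateTop b) :=
  (contMDiff_translateTop b).mdifferentiable (by simp)

/-- … and so are their inverses. [cite: Lange2023AbelianVarietiesComplex, §1.1.4] -/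
theorem mdifferentiable_translateTop_symm (b : E) :
    MDifferentiable 𝓘(ℂ, E) 𝓘(ℂ, E) (translateTop b).symm := by
  have h : ((translateTop b).symm : (⊤ : Opens E) → (⊤ : Opens E)) = translateTop (-b) := by
    funext x; exact Subtype.ext rfl
  rw [h]
  exact mdifferentiable_translateTop (-b)

/-- **The regular locus of a translation-invariant set is translation-invariant** (regular points
are invariant under biholomorphisms; Chirka (1989), §2.3). [cite: Chirka1989, §2.3] -/
theorem regularLocus_translateTop {A : Set (⊤ : Opens E)} {b : E} (hA : translateTop b ⁻¹' A = A)
    (x : (⊤ : Opens E)) : translateTop b x ∈ regularLocus 𝓘(ℂ, E) A ↔ x ∈ regularLocus 𝓘(ℂ, E) A := by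
  constructor
  · intro hx
    -- apply the inverse translation
    have hA' : (translateTop b).symm ⁻¹' A = A := by
      ext z
      have hz := Set.ext_iff.1 hA ((translateTop b).symm z)
      rw [mem_preimage, Homeomorph.apply_symm_apply] at hz
      rw [mem_preimage]
      exact hz.symm
    have h := mem_regularLocus_of_preimage_homeomorph (I := 𝓘(ℂ, E)) (I' := 𝓘(ℂ, E))
      (translateTop b).symm (mdifferentiable_translateTop_symm b) (by
        simpa only [Homeomorph.symm_symm] using mdifferentiable_translateTop b)
      (Z := A) (x := translateTop b x) (by rwa [hA'])
    simpa only [Homeomorph.symm_apply_apply] using h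
  · intro hx
    exact mem_regularLocus_of_preimage_homeomorph (I := 𝓘(ℂ, E)) (I' := 𝓘(ℂ, E)) (translateTop b)
      (mdifferentiable_translateTop b) (mdifferentiable_translateTop_symm b) (by rwa [hA])

end Translate

end ComplexTorus

/-! ### The chain of a `Λ`-periodic analytic set -/

namespace HolomorphicChain

variable {ι : Type*} {E : Type u} [NormedAddCommGroup E] [InnerProductSpace ℂ E] [FiniteDimensional ℂ E]
  (Φ : (ι → ℝ) ≃L[ℝ] E) {p : ℕ}

/-- **The carrier `reg A` of the chain of a `Λ`-periodic analytic set is `Λ`-periodic.**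
[cite: Chirka1989, §2.3] -/
theorem carrier_ofSet_periodic {A : Set (⊤ : Opens E)} (hA : HasPureDim 𝓘(ℂ, E) A p)
    (hper : ∀ m : ι → ℤ, ComplexTorus.translateTop (ComplexTorus.latticeVec Φ m) ⁻¹' A = A)
    (m : ι → ℤ) (x : E) :
    ComplexTorus.latticeVec Φ m + x ∈ (ofSet A hA).carrier ↔ x ∈ (ofSet A hA).carrier := by
  rw [carrier_ofSet]
  constructor
  · rintro ⟨y, hy, hyx⟩
    refine ⟨⟨x, trivial⟩, ?_, rfl⟩
    have hy' : y = ComplexTorus.translateTop (ComplexTorus.latticeVec Φ m) ⟨x, trivial⟩ :=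
      Subtype.ext (by rw [ComplexTorus.coe_translateTop]; exact hyx)
    rw [hy'] at hy
    exact (ComplexTorus.regularLocus_translateTop (hper m) _).1 hy
  · rintro ⟨y, hy, hyx⟩
    refine ⟨ComplexTorus.translateTop (ComplexTorus.latticeVec Φ m) y, ?_, by
      rw [ComplexTorus.coe_translateTop, hyx]⟩
    exact (ComplexTorus.regularLocus_translateTop (hper m) _).2 hy

variable [MeasurableSpace E] [BorelSpace E]

/-- **The orientation frame of the chain of a `Λ`-periodic analytic set is `Λ`-periodic.**
[cite: Federer1969, 3.2.16] -/
theorem orientationFrame_ofSet_periodic {A : Set (⊤ : Opens E)} (hA : HasPureDim 𝓘(ℂ, E) A p)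
    (hper : ∀ m : ι → ℤ, ComplexTorus.translateTop (ComplexTorus.latticeVec Φ m) ⁻¹' A = A)
    (m : ι → ℤ) (x : E) :
    (ofSet A hA).orientationFrame (ComplexTorus.latticeVec Φ m + x) = (ofSet A hA).orientationFrame x :=
  (ofSet A hA).orientationFrame_const_add (Set.ext fun y ↦ carrier_ofSet_periodic Φ hA hper m y) x

variable [Fintype ι]

/-- **The period functional of a `Λ`-periodic analytic set is independent of the fundamental domain.**
For a `Λ`-periodic pure `p`-dimensional analytic subset `A ⊆ E` (the lift of a closed analytic
subvariety of the torus `X = E/Λ`), `torusPeriod Φ [A] = constPeriod [A] D` for every admissible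
fundamental domain `D` of `Λ` (for `𝓗^{2p} ⌞ reg A`): the current of integration `ω ↦ ∫_{A/Λ} ω` of
the analytic cycle `A/Λ ⊂ X` on the invariant forms `H^{2p}(X, ℂ)` is well defined
(Voisin (2002), §11.1.2; Chirka (1989), §14.1). [cite: VoisinHodgeI2002, §11.1.2 Cor. 11.15] -/
theorem torusPeriod_ofSet_eq_constPeriod {A : Set (⊤ : Opens E)} (hA : HasPureDim 𝓘(ℂ, E) A p)
    (hper : ∀ m : ι → ℤ, ComplexTorus.translateTop (ComplexTorus.latticeVec Φ m) ⁻¹' A = A)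
    {D : Set E}
    (hD : IsAddFundamentalDomain (ComplexTorus.periodLattice Φ) D
      ((μHE[2 * p] : Measure E).restrict (ofSet A hA).carrier))
    (hDi : IntegrableOn (fun x ↦ ((ofSet A hA).density x : ℝ) • frameVector ((ofSet A hA).orientationFrame x))
      D ((μHE[2 * p] : Measure E).restrict (ofSet A hA).carrier)) :
    (ofSet A hA).torusPeriod Φ = (ofSet A hA).constPeriod D :=
  (ofSet A hA).torusPeriod_eq_constPeriod_of_periodic_carrier Φ (carrier_ofSet_periodic Φ hA hper)
    (fun m x hx ↦ by
      rw [density_ofSet_of_mem_carrier hA hx,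
        density_ofSet_of_mem_carrier hA ((carrier_ofSet_periodic Φ hA hper m x).2 hx)])
    hD hDi

/-- In particular every period box `Φ(a + [0,1)^ι)` computes the same periods of `A/Λ`.
[cite: VoisinHodgeI2002, §11.1.2 Cor. 11.15] -/
theorem torusPeriod_ofSet_eq_constPeriod_periodBox {A : Set (⊤ : Opens E)}
    (hA : HasPureDim 𝓘(ℂ, E) A p)
    (hper : ∀ m : ι → ℤ, ComplexTorus.translateTop (ComplexTorus.latticeVec Φ m) ⁻¹' A = A)
    (a : ι → ℝ) :
    (ofSet A hA).torusPeriod Φ = (ofSet A hA).constPeriod (ComplexTorus.periodBox Φ a) :=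
  torusPeriod_ofSet_eq_constPeriod Φ hA hper (ComplexTorus.isAddFundamentalDomain_periodBox Φ a _)
    ((ofSet A hA).integrableOn_density_smul_frameVector_periodBox Φ a)

end HolomorphicChain

end Literature.Geometry.Kaehler

end
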